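import Summits.BirchSwinnertonDyer.BirchSwinnertonDyer.Theorems.SmallImageMuTransferMuTransferX9TameClass
import Literature.NumberTheory.EllipticCurves.Kato2004.EulerSystemBoundFineSelmerTwo
import Literature.NumberTheory.EllipticCurves.CyclotomicZpExtensionLayerTwoProofs
import HarnessLib

/-!
# Route ByReductionTypeAtTwo, crux `OrdKatoHalfAtTwoIso` (stmt-BirchSwinnertonDyer-19573), line
# `steinberg-fibre-at-two` (skeleton v5): helper W3c (trunk T3 = sidea-stub_port-1 H16) — THE GENUINE
# TAME CLASS at `p = 2`, from `Kato2004.IsEulerSystemClassTwo s`: at every tame prime `q`, the INTEGRAL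
# class `y = 𝐳̄_q ∈ H¹(Gal(ℚ̄/ℚ(μ_q)), 𝒯_{2ⁿ})` whose corestriction to `ℚ` is `P̄_q((1+T)^{κ̄(Fr_q)}) · 𝐳̄₁`,
# `𝐳̄₁ = (I.redTower s)_{2ⁿ}`

HONEST FRAMING (cell bsd-2adic): BSD is not proved by any of this; the crux `OrdKatoHalfAtTwoIso` is NOT
proved here; none of the line's registered stubs is proved here; nothing is booked.  This file is a
KERNEL HELPER for the line `Cruxes/OrdKatoHalfAtTwoIso/Lines/steinberg_fibre_at_two.lean`
(`--supports … --as helper`; it is not one of the line's registered stubs): the genuine tame class at `2`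
for the Ω road of `stub_port` (step K1 of the registered stub `stub_HK_kolyvaginRankOneTwo`), typed by
the side seat sidea-stub_port-1 as H16 (`StubPortHelpersAtTwo.lean` §C, credit: sidea-stub_port-1) and
proved here VERBATIM along the odd twin
`Rank1Residual.TameClass.exists_tameClass_of_isEulerSystemClass` (file `…SmallImageMuTransferMuTransferX9TameClass`,
cell bsd-smallim), whose only `p`-dependence is the layer index: `ℚ_n ⊂ ℚ(μ_{p^{n+1}})` for odd `p`,
`ℚ_n = ℚ(ζ_{2^{n+2}})⁺ ⊂ ℚ(μ_{2^{n+2}})` at `2` (Washington §13.1).  THEOREMS ONLY (no definition, no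
named fact, no `sorry`).

## What

**`TameClass.exists_tameClass_of_isEulerSystemClassTwo`** — for a GENUINE `2`-adic Λ-adic Euler-system
class `s` (`IsEulerSystemClassTwo W hκ I s`: `s` is the layerwise corestriction `levelToLayerTwo` of an
INTEGRAL Euler system `z` for `T₂W` over the cyclotomic levels away from a finite `S`, the `n`-th layer
read TWO levels up, `I.proj n s = Cor_{ℚ(μ_{2^{n+2}})/ℚ_n} z_{n+2,∅}`): there is a finite `S₀` such that
for every place `q ∉ S₀` (with prime `ℓ`), every layer `n`, every arithmetic Frobenius `Fr` at `q`, every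
integer lift `P̄ ∈ ℤ[X]` of the Euler factor `P(Fr⁻¹ | T₂W*; X) mod 2` and every `a ≡ κ̄_n(Fr) (mod 2ⁿ)`,
there is `y ∈ H¹(N, 𝒯_{2ⁿ})`, `N = Gal(ℚ̄/ℚ(μ_ℓ))`, `𝒯_{2ⁿ} = κ.twistModP E[2] _ (2ⁿ)`, with (i)
`y ∈ integralH1` (Kato (8.1.3)) and (ii) `cor_N^{Γ_ℚ} y = P̄((1+T)^a) · (I.redTower s)_{2ⁿ}` in cocycle
form.  Construction: `y := cor_{N∩Γ_n}^{N} ∘ H¹(m ↦ m T⁰) ∘ red ∘ cor_{ℚ(μ_{2^{n+2}},μ_ℓ) → N∩Γ_n}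
(z_{n+2,{q}})`; proof = the odd proof with `z (n+1) ↦ z (n+2)`, the layer inclusion
`h n ↦ hκ.cyclotomicLevelsRat_level_le_layerSubgroup_two S n`, `coresToLayer ↦ levelToLayerTwo`
(a `coresLe`, definitionally); the engines `coresLe_cons_mem_integralH1`,
`coresLe_reduceH1_coresLe_cons_eq_aeval` (file `…X9EulerSystemTameNorm`) take the level as a parameter,
and `prime(q) ≠ 2` is supplied by the exceptional set `S₀ = S ∪ {places of 2}`.  NOTHING about the
image of `ρ̄` or the splitting of `q` enters.

References: K. Kato, Astérisque 295 (2004) (8.1.3), §13.1 (13.1.1), Ex. 13.3, §13.8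
[Kato2004Asterisque]; K. Rubin, *Euler Systems* (2000) Def. 2.1.1, Lemma 4.4.2 [Rubin2000]; J.-P. Serre,
*Galois Cohomology* (1997) I §2.5 Prop. 10 [SerreGaloisCohomology1997]; L. C. Washington, *Introduction
to Cyclotomic Fields* §13.1 [Washington1997]; tree: `…SmallImageMuTransferMuTransferX9TameClass` (odd
twin, proof pattern), `Kato2004/EulerSystemBoundFineSelmerTwo` (`IsEulerSystemClassTwo`),
`Kato2004/IwasawaCohomologyZetaLiftTwo` (`levelToLayerTwo`), `CyclotomicZpExtensionLayerTwoProofs`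
(`IsCyclotomic.cyclotomicLevelsRat_level_le_layerSubgroup_two`).
-/

-- the summit and its single problem are both named `BirchSwinnertonDyer` (registry layout D-0017)
set_option linter.dupNamespace false
set_option autoImplicit false

noncomputable section

open CategoryTheory Function Finset Polynomial
open scoped NumberField Pointwise ContRepresentation
open Field IsDedekindDomain
open Literature.NumberTheory.GaloisRepresentations
open Literature.NumberTheory.EllipticCurves
open Literature.NumberTheory.EllipticCurves.ZpExtension
open Literature.NumberTheory.EllipticCurves.Kato2004
open Literature.NumberTheory.EllipticCurves.Kato2004.EulerSystemValues
open Rat.HeightOneSpectrum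
open Summit.BirchSwinnertonDyer.Rank1Residual.GaloisImage

universe u

namespace Summit.BirchSwinnertonDyer.BirchSwinnertonDyer.Rank1Residual.TameClass

/-! ## The genuine tame class at `p = 2` -/

section TameClassTwo

variable (W : WeierstrassCurve ℚ) [W.IsElliptic]
  [ContinuousSMul ℤ_[2] (W.tateModule 2)]
  [Module.Free ℤ_[2] (W.tateModule 2)] [Module.Finite ℤ_[2] (W.tateModule 2)]
  (κ : ZpExtension ℚ 2) (hκ : κ.IsCyclotomic) (γ : absoluteGaloisGroup ℚ) (I : IwasawaH1Data W 2 κ γ)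

/-- **THE GENUINE TAME CLASS at `p = 2` (H16; input of step K1 of the Ω road).**  Let `s ∈ 𝐇¹_Γ(T₂W)`
be a genuine `2`-adic Λ-adic Euler-system class (`IsEulerSystemClassTwo`: `s` is the layerwise
corestriction `Cor_{ℚ(μ_{2^{n+2}})/ℚ_n}` of an INTEGRAL Euler system `z` for `T₂W` over the cyclotomic
levels away from a finite `S`).  Then there is a finite set `S₀` of places (`S` and the place of `2`)
such that for every place `q ∉ S₀` with prime `ℓ`, every layer `n`, every arithmetic Frobenius `Fr` at
`q`, every `P̄ ∈ ℤ[X]` lifting `P(Fr⁻¹ | T₂W*; X) mod 2` and every `a ≡ κ̄_n(Fr) (mod 2ⁿ)`, there is a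
class `y ∈ H¹(Gal(ℚ̄/ℚ(μ_ℓ)), 𝒯_{2ⁿ})`, `𝒯_{2ⁿ} = E[2] ⊗ 𝔽₂[T]/(T^{2ⁿ})(χ_κ)` (`= W.modPTwist 2 κ (2ⁿ)`
definitionally), which is (i) INTEGRAL (`Kato2004.integralH1`: vanishing on `N ∩ I_𝔓` for every
`𝔓 ∣ v ≠ 2`), and (ii) satisfies the NORM RELATION `cor_N^{Γ_ℚ} y = P̄((1+T)^a) · 𝐳̄₁` in cocycle form:
for every cocycle `φ` of `𝐳̄₁ := (I.redTower s)_{2ⁿ}` there is a cocycle `ψ` with VALUES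
`ψ(g) = P̄((1+S)^a)(φ(g))` and `cor_N^{Γ_ℚ} y = [ψ]`.  This is Kato's
`cor_{ℚ(μ_q)/ℚ} 𝐳̄_q = P_q(Fr_q⁻¹)·𝐳̄₁` (Astérisque 295 (13.1.1), Ex. 13.3) read modulo `(2, T^{2ⁿ})`
through Shapiro's lemma; `y` is `cor_{N∩Γ_n}^{N}(H¹(m ↦ m T⁰)(red (cor z_{n+2,{q}})))` (relative inverse
Shapiro, level `n + 2` since `ℚ_n ⊂ ℚ(μ_{2^{n+2}})`).  The `p = 2` twin of
`exists_tameClass_of_isEulerSystemClass`.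
[cite: Kato2004Asterisque, (8.1.3), §13.1 (13.1.1), Ex. 13.3 (pp. 224–225) and §13.8 (p. 228)]
[cite: Rubin2000, Def. 2.1.1 and Lemma 4.4.2] [cite: SerreGaloisCohomology1997, I §2.5 Prop. 10 and (b)]
[cite: Washington1997, §13.1] -/
theorem exists_tameClass_of_isEulerSystemClassTwo {s : I.H}
    (hES : IsEulerSystemClassTwo W hκ I s) :
    ∃ S₀ : Set (HeightOneSpectrum (𝓞 ℚ)), S₀.Finite ∧
      ∀ (q : HeightOneSpectrum (𝓞 ℚ)), q ∉ S₀ →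
      ∀ (n : ℕ) (Fr : absoluteGaloisGroup ℚ), IsArithFrobAtPlace ℚ q Fr →
      ∀ (Pz : ℤ[X]), Pz.map (Int.castRingHom (ZMod 2)) =
          (rubinEulerFactor (tateRep W 2).toRepresentation
            (cyclotomicCharacterToUnits ℚ 2 ℤ_[2]) Fr).map (PadicInt.toZMod (p := 2)) →
      ∀ (a : ℕ), (a : ZMod (2 ^ n)) = κ.layerIndex n Fr →
      ∀ [Fintype (absoluteGaloisGroup ℚ ⧸ rootsOfUnityFixer ℚ ((primesEquiv q : Nat.Primes) : ℕ))]
        (hN : IsOpen ((rootsOfUnityFixer ℚ ((primesEquiv q : Nat.Primes) : ℕ) :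
          Subgroup (absoluteGaloisGroup ℚ)) : Set (absoluteGaloisGroup ℚ))),
      ∃ y : H1 (κ.twistModP (W.torsionGaloisModule (2 : ℤ)) IwasawaH1Data.torsion_nsmul_eq_zero (2 ^ n))
          (rootsOfUnityFixer ℚ ((primesEquiv q : Nat.Primes) : ℕ)),
        y ∈ integralH1 (κ.twistModP (W.torsionGaloisModule (2 : ℤ))
          IwasawaH1Data.torsion_nsmul_eq_zero (2 ^ n)) 2
          (rootsOfUnityFixer ℚ ((primesEquiv q : Nat.Primes) : ℕ)) ∧
        ∀ φ : contOneCocycles (κ.twistModP (W.torsionGaloisModule (2 : ℤ))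
            IwasawaH1Data.torsion_nsmul_eq_zero (2 ^ n)).toTopRep,
          oneCocycleClass _ φ = (I.redTower s : ∀ J : ℕ, galoisCohomology (κ.twistModP
            (W.torsionGaloisModule (2 : ℤ)) IwasawaH1Data.torsion_nsmul_eq_zero J) 1) (2 ^ n) →
          ∃ ψ : contOneCocycles (κ.twistModP (W.torsionGaloisModule (2 : ℤ))
              IwasawaH1Data.torsion_nsmul_eq_zero (2 ^ n)).toTopRep,
            (∀ g, ψ.1 g = aeval (unipotentPow (WeierstrassCurve.geomTorsion W (2 : ℤ)) (2 ^ n) a) Pz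
              (φ.1 g)) ∧
            cores (κ.twistModP (W.torsionGaloisModule (2 : ℤ)) IwasawaH1Data.torsion_nsmul_eq_zero
              (2 ^ n)).toTopRep (rootsOfUnityFixer ℚ ((primesEquiv q : Nat.Primes) : ℕ)) hN y =
              oneCocycleClass _ ψ := by
  classical
  obtain ⟨S, hSfin, z, hz, hint, hproj⟩ := hES
  -- the exceptional set: `S` and the place of `2` (`= p`)
  refine ⟨S ∪ {v | ((primesEquiv v : Nat.Primes) : ℕ) = 2}, hSfin.union ?_, ?_⟩
  · have hinj : Set.InjOn (fun v : HeightOneSpectrum (𝓞 ℚ) ↦ ((primesEquiv v : Nat.Primes) : ℕ))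
        ((fun v : HeightOneSpectrum (𝓞 ℚ) ↦ ((primesEquiv v : Nat.Primes) : ℕ)) ⁻¹' {2}) :=
      fun a _ b _ hab ↦ primesEquiv.injective (Subtype.ext hab)
    exact (Set.toFinite ({2} : Set ℕ)).preimage hinj
  intro q hq0 n Fr hFr Pz hPz a ha _ hN
  simp only [Set.mem_union, Set.mem_setOf_eq, not_or] at hq0
  obtain ⟨hqS, hq2⟩ := hq0
  have hq : q ∈ (cyclotomicLevelsRat 2 S).primes := ⟨hqS, hq2⟩
  haveI : NeZero ((primesEquiv q : Nat.Primes) : ℕ) := ⟨(primesEquiv q).2.ne_zero⟩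
  haveI : NeZero (((primesEquiv q : Nat.Primes) : ℕ) : ℚ) :=
    ⟨Nat.cast_ne_zero.mpr (primesEquiv q).2.ne_zero⟩
  haveI hNn : (rootsOfUnityFixer ℚ ((primesEquiv q : Nat.Primes) : ℕ)).Normal :=
    Subgroup.Normal.of_commutator_le _ (commutator_le_rootsOfUnityFixer ℚ _)
  -- the layer inclusion `Gal(ℚ̄/ℚ(μ_{2^{n+2}})) ≤ Gal(ℚ̄/ℚ_n)` (Washington §13.1)
  have h : (cyclotomicLevelsRat 2 S).level (n + 2) ∅ ≤ κ.layerSubgroup n :=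
    hκ.cyclotomicLevelsRat_level_le_layerSubgroup_two S n
  -- the subgroups `V = Gal(ℚ̄/ℚ(μ_{2^{n+2}}, μ_ℓ)) ≤ U = N ∩ Γ_n ≤ Γ_n`, `U ≤ N`
  have hUo : IsOpen ((rootsOfUnityFixer ℚ ((primesEquiv q : Nat.Primes) : ℕ) ⊓ κ.layerSubgroup n :
      Subgroup (absoluteGaloisGroup ℚ)) : Set (absoluteGaloisGroup ℚ)) :=
    isOpen_inf_layerSubgroup κ n _ hN
  have hle : (cyclotomicLevelsRat 2 S).level (n + 2) ((cyclotomicLevelsRat 2 S).idealOne.cons q hq).1 ≤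
      (cyclotomicLevelsRat 2 S).level (n + 2) ∅ :=
    (cyclotomicLevelsRat 2 S).level_insert_le (n + 2) (cyclotomicLevelsRat 2 S).idealOne.1 q
  have hVU : (cyclotomicLevelsRat 2 S).level (n + 2) ((cyclotomicLevelsRat 2 S).idealOne.cons q hq).1 ≤
      rootsOfUnityFixer ℚ ((primesEquiv q : Nat.Primes) : ℕ) ⊓ κ.layerSubgroup n := by
    intro g hg
    refine ⟨?_, h (hle hg)⟩
    rw [EulerSystemLevels.mem_level_iff] at hg
    exact hg.2 q (Finset.mem_insert_self q _)
  -- finiteness instances (all `Fintype.ofFinite`, matching `levelToLayerTwo` / `coresCons`)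
  haveI : (rootsOfUnityFixer ℚ ((primesEquiv q : Nat.Primes) : ℕ) ⊓ κ.layerSubgroup n).FiniteIndex :=
    finiteIndex_of_isOpen_of_compactSpace _ hUo
  haveI : ((cyclotomicLevelsRat 2 S).level (n + 2) ∅).FiniteIndex :=
    finiteIndex_of_isOpen_of_compactSpace _ ((cyclotomicLevelsRat 2 S).isOpen_level (n + 2) ∅)
  letI : Fintype (absoluteGaloisGroup ℚ ⧸ κ.layerSubgroup n) := κ.fintypeQuotientLayer n
  letI : Fintype (absoluteGaloisGroup ℚ ⧸
      (rootsOfUnityFixer ℚ ((primesEquiv q : Nat.Primes) : ℕ) ⊓ κ.layerSubgroup n)) :=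
    Fintype.ofFinite _
  letI : Fintype (↥(rootsOfUnityFixer ℚ ((primesEquiv q : Nat.Primes) : ℕ)) ⧸
      (rootsOfUnityFixer ℚ ((primesEquiv q : Nat.Primes) : ℕ) ⊓ κ.layerSubgroup n).subgroupOf
        (rootsOfUnityFixer ℚ ((primesEquiv q : Nat.Primes) : ℕ))) :=
    Fintype.ofFinite _
  letI : Fintype (↥(κ.layerSubgroup n) ⧸
      (rootsOfUnityFixer ℚ ((primesEquiv q : Nat.Primes) : ℕ) ⊓ κ.layerSubgroup n).subgroupOf
        (κ.layerSubgroup n)) :=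
    Fintype.ofFinite _
  letI : Fintype (↥(κ.layerSubgroup n) ⧸
      ((cyclotomicLevelsRat 2 S).level (n + 2) ∅).subgroupOf (κ.layerSubgroup n)) :=
    Fintype.ofFinite _
  letI : Fintype (↥(rootsOfUnityFixer ℚ ((primesEquiv q : Nat.Primes) : ℕ) ⊓ κ.layerSubgroup n) ⧸
      ((cyclotomicLevelsRat 2 S).level (n + 2) ((cyclotomicLevelsRat 2 S).idealOne.cons q hq).1).subgroupOf
        (rootsOfUnityFixer ℚ ((primesEquiv q : Nat.Primes) : ℕ) ⊓ κ.layerSubgroup n)) :=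
    Fintype.ofFinite _
  -- the tame class at the layer `ℚ_n(μ_ℓ)` with `T₂W`-coefficients: integral, and so is its reduction
  have hyT : coresLe (tateRep W 2).toTopRep hVU ((cyclotomicLevelsRat 2 S).isOpen_level (n + 2) _)
      (z (n + 2) ((cyclotomicLevelsRat 2 S).idealOne.cons q hq)) ∈
      integralH1 (tateRep W 2) 2
        (rootsOfUnityFixer ℚ ((primesEquiv q : Nat.Primes) : ℕ) ⊓ κ.layerSubgroup n) :=
    coresLe_cons_mem_integralH1 W 2 hint (n + 2) hq hVU
  have hred := reduceH1_mem_integralH1 W 2 _ hyT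
  -- the norm relation at the layer, modulo `2`
  have hnorm : coresLe (W.torsionGaloisModule (2 : ℤ)).toTopRep
        (inf_le_right : rootsOfUnityFixer ℚ ((primesEquiv q : Nat.Primes) : ℕ) ⊓ κ.layerSubgroup n ≤
          κ.layerSubgroup n) hUo
        (reduceH1 W 2 _ (coresLe (tateRep W 2).toTopRep hVU
          ((cyclotomicLevelsRat 2 S).isOpen_level (n + 2) _)
          (z (n + 2) ((cyclotomicLevelsRat 2 S).idealOne.cons q hq)))) =
      aeval (conjMap (W.torsionGaloisModule (2 : ℤ)).toTopRep (κ.layerSubgroup n) Fr⁻¹ 1).hom.toLinearMap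
        Pz (I.red s n) := by
    rw [I.red_apply, hproj n]
    exact coresLe_reduceH1_coresLe_cons_eq_aeval W 2 hz (n + 2) hq hq2 hFr Pz hPz hUo h
      (inf_le_right : rootsOfUnityFixer ℚ ((primesEquiv q : Nat.Primes) : ℕ) ⊓ κ.layerSubgroup n ≤ _)
      hVU
  have ha' : (a : ZMod (2 ^ n)) = -κ.layerIndex n Fr⁻¹ := by rw [κ.layerIndex_inv, neg_neg, ha]
  -- the class `y` (relative inverse Shapiro of the reduced layer class)
  refine ⟨coresLe (κ.twistModP (W.torsionGaloisModule (2 : ℤ)) IwasawaH1Data.torsion_nsmul_eq_zero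
        (2 ^ n)).toTopRep
      (inf_le_left : rootsOfUnityFixer ℚ ((primesEquiv q : Nat.Primes) : ℕ) ⊓ κ.layerSubgroup n ≤
        rootsOfUnityFixer ℚ ((primesEquiv q : Nat.Primes) : ℕ)) hUo
      (cohomologyMap (restrictHomOfLe
        (inf_le_right : rootsOfUnityFixer ℚ ((primesEquiv q : Nat.Primes) : ℕ) ⊓ κ.layerSubgroup n ≤
          κ.layerSubgroup n)
        (κ.unitCoeffHom (W.torsionGaloisModule (2 : ℤ)) IwasawaH1Data.torsion_nsmul_eq_zero n)) 1
        (reduceH1 W 2 _ (coresLe (tateRep W 2).toTopRep hVU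
          ((cyclotomicLevelsRat 2 S).isOpen_level (n + 2) _)
          (z (n + 2) ((cyclotomicLevelsRat 2 S).idealOne.cons q hq))))), ?_, ?_⟩
  · -- (i) integrality
    refine coresLe_mem_integralH1_inf _ 2 hUo (fun v hv 𝔓 h𝔓 ↦ ?_)
      (cohomologyMap_mem_integralH1 (W.torsionGaloisModule (2 : ℤ)) _ 2 _ hred)
    exact CoresUnramified.subgroupIsUnramifiedAt_layerSubgroup κ
      (WeierstrassCurve.natCast_not_mem_asIdeal_of_primesEquiv_ne Fact.out hv) n 𝔓 h𝔓
  · -- (ii) the norm relation, in cocycle form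
    intro φ hφ
    have hφ' : oneCocycleClass _ φ = κ.coresShapiro (W.torsionGaloisModule (2 : ℤ))
        IwasawaH1Data.torsion_nsmul_eq_zero n (I.red s n) := by
      rw [hφ, I.redTower_apply_coe_pow s n, I.red_apply]
      -- `(2 : ℤ)` (numeral, statement) vs `((2 : ℕ) : ℤ)` (cast, `I.redTower`): definitionally equal
      rfl
    obtain ⟨ψ, hψ, hclass⟩ := exists_cocycle_coresShapiro_aeval_conjMap κ
      (W.torsionGaloisModule (2 : ℤ)) IwasawaH1Data.torsion_nsmul_eq_zero n Fr⁻¹ ha' Pz (I.red s n) φ hφ'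
    refine ⟨ψ, hψ, ?_⟩
    rw [cores_coresLe_cohomologyMap_unitCoeff κ (W.torsionGaloisModule (2 : ℤ))
      IwasawaH1Data.torsion_nsmul_eq_zero n _ hN hUo, hnorm]
    exact hclass

end TameClassTwo

end Summit.BirchSwinnertonDyer.BirchSwinnertonDyer.Rank1Residual.TameClass

end
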